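import Summits.Ventures.PercRepro.MSTheoremS

/-!
# The mixed-cell lemma (TL) on a ground set

`MSTheoremS.lean` proves the general mixed-cell lemma `mem_or_compl_mem_of_tight` for families on
`Finset.univ`: if every member of a tight nonempty family `F` has both agreement cells or both
disagreement cells of a set `w` among the differences `F \\ F`, then `w` or `univ \ w` is a member.
Here the same statement is proved for a family of subsets of an arbitrary finite ground set
`S : Finset α` (cells and complements taken inside `S`), by transporting the family to the subtype
`↥S` (`toSub`), where the differences, the cardinalities and the cells transport verbatim.

This is the form needed for the trace `proj r F` of a family on the ground set `univ.erase r`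
(Lemma 1 of proofs/MINE1-theoremS.md, Addendum 36: the flipped near-member of a residue instance is
a member of the trace or its complement in `S ∖ r` is).
-/

namespace PercRepro.MSTight

open Finset
open scoped FinsetFamily symmDiff

variable {α : Type*} [DecidableEq α]

/-- A family of subsets of `S`, transported to the subtype `↥S`. -/
def toSub (S : Finset α) (F : Finset (Finset α)) : Finset (Finset S) :=
  F.image fun t => t.subtype (· ∈ S)

/-- `Finset.subtype` is injective on subsets of `S`. -/
theorem subtype_inj_of_subset {S t t' : Finset α} (ht : t ⊆ S) (ht' : t' ⊆ S)
    (h : t.subtype (· ∈ S) = t'.subtype (· ∈ S)) : t = t' := by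
  have h1 : (t.subtype (· ∈ S)).map (Function.Embedding.subtype _) = t := by
    rw [Finset.subtype_map]; exact Finset.filter_true_of_mem ht
  have h2 : (t'.subtype (· ∈ S)).map (Function.Embedding.subtype _) = t' := by
    rw [Finset.subtype_map]; exact Finset.filter_true_of_mem ht'
  rw [← h1, ← h2, h]

/-- `Finset.subtype` commutes with set difference. -/
theorem subtype_sdiff' (S t t' : Finset α) :
    (t \ t').subtype (· ∈ S) = t.subtype (· ∈ S) \ t'.subtype (· ∈ S) := by
  ext x; simp [Finset.mem_subtype, Finset.mem_sdiff]

/-- `Finset.subtype` commutes with intersection. -/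
theorem subtype_inter' (S t t' : Finset α) :
    (t ∩ t').subtype (· ∈ S) = t.subtype (· ∈ S) ∩ t'.subtype (· ∈ S) := by
  ext x; simp [Finset.mem_subtype, Finset.mem_inter]

/-- The transported complement inside `S` is the complement in `↥S`. -/
theorem subtype_sdiff_self (S t : Finset α) :
    (S \ t).subtype (· ∈ S) = Finset.univ \ t.subtype (· ∈ S) := by
  ext x; simp [Finset.mem_subtype, Finset.mem_sdiff, x.2]

/-- For `w ⊆ S`, the transported `w` is a member of `toSub S F` iff `w` is a member of `F`. -/
theorem mem_toSub_iff {S w : Finset α} {F : Finset (Finset α)} (hFS : ∀ t ∈ F, t ⊆ S)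
    (hw : w ⊆ S) : w.subtype (· ∈ S) ∈ toSub S F ↔ w ∈ F := by
  unfold toSub
  rw [Finset.mem_image]
  constructor
  · rintro ⟨t, ht, h⟩
    rw [subtype_inj_of_subset (hFS t ht) hw h] at ht
    exact ht
  · intro hw'
    exact ⟨w, hw', rfl⟩

/-- Members of `F` transport to members of `toSub S F`. -/
theorem subtype_mem_toSub {S t : Finset α} {F : Finset (Finset α)} (ht : t ∈ F) :
    t.subtype (· ∈ S) ∈ toSub S F :=
  Finset.mem_image_of_mem _ ht

/-- Transporting a family of subsets of `S` preserves its cardinality. -/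
theorem card_toSub {S : Finset α} {F : Finset (Finset α)} (hFS : ∀ t ∈ F, t ⊆ S) :
    (toSub S F).card = F.card := by
  unfold toSub
  apply Finset.card_image_of_injOn
  intro t ht t' ht' h
  exact subtype_inj_of_subset (hFS t ht) (hFS t' ht') h

/-- The differences of the transported family are the transported differences. -/
theorem toSub_diffs (S : Finset α) (F : Finset (Finset α)) :
    toSub S F \\ toSub S F = toSub S (F \\ F) := by
  ext X
  simp only [toSub, Finset.mem_diffs, Finset.mem_image]
  constructor
  · rintro ⟨a, ⟨t, ht, rfl⟩, b, ⟨t', ht', rfl⟩, rfl⟩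
    exact ⟨t \ t', ⟨t, ht, t', ht', rfl⟩, subtype_sdiff' S t t'⟩
  · rintro ⟨d, ⟨t, ht, t', ht', rfl⟩, rfl⟩
    exact ⟨_, ⟨t, ht, rfl⟩, _, ⟨t', ht', rfl⟩, (subtype_sdiff' S t t').symm⟩

/-- Differences of subsets of `S` are subsets of `S`. -/
theorem diffs_subset_of_subset {S : Finset α} {F : Finset (Finset α)} (hFS : ∀ t ∈ F, t ⊆ S) :
    ∀ d ∈ F \\ F, d ⊆ S := by
  intro d hd
  obtain ⟨t, ht, t', _, rfl⟩ := Finset.mem_diffs.1 hd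
  exact (Finset.sdiff_subset).trans (hFS t ht)

/-- A tight family of subsets of `S` transports to a tight family on `↥S`. -/
theorem tight_toSub {S : Finset α} {F : Finset (Finset α)} (hF : Tight F) (hFS : ∀ t ∈ F, t ⊆ S) :
    Tight (toSub S F) := by
  unfold Tight
  rw [toSub_diffs, card_toSub (diffs_subset_of_subset hFS), card_toSub hFS]
  exact hF

/-- **The mixed-cell lemma (TL) on a ground set.** Let `F` be a tight nonempty family of subsets
of `S` and `w ⊆ S`. If every member `t` has both agreement cells `t ∩ w`, `(S ∖ t) ∩ (S ∖ w)` or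
both disagreement cells `t ∩ (S ∖ w)`, `(S ∖ t) ∩ w` among the differences `F \\ F`, then `w` or
`S ∖ w` is a member. -/
theorem mem_or_sdiff_mem_of_tight_of_subset {S : Finset α} {F : Finset (Finset α)} (hF : Tight F)
    (hne : F.Nonempty) (hFS : ∀ t ∈ F, t ⊆ S) (w : Finset α) (hw : w ⊆ S)
    (hcond : ∀ t ∈ F, (t ∩ w ∈ F \\ F ∧ (S \ t) ∩ (S \ w) ∈ F \\ F) ∨
      (t ∩ (S \ w) ∈ F \\ F ∧ (S \ t) ∩ w ∈ F \\ F)) :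
    w ∈ F ∨ S \ w ∈ F := by
  have hF' : Tight (toSub S F) := tight_toSub hF hFS
  have hne' : (toSub S F).Nonempty := by
    obtain ⟨t, ht⟩ := hne
    exact ⟨_, subtype_mem_toSub ht⟩
  have key := mem_or_compl_mem_of_tight hF' hne' (w.subtype (· ∈ S)) ?_
  · rcases key with h | h
    · left
      exact (mem_toSub_iff hFS hw).1 h
    · right
      rw [← subtype_sdiff_self] at h
      exact (mem_toSub_iff hFS Finset.sdiff_subset).1 h
  · intro t' ht'
    obtain ⟨t, ht, rfl⟩ := Finset.mem_image.1 ht'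
    rw [toSub_diffs]
    rcases hcond t ht with ⟨h1, h2⟩ | ⟨h1, h2⟩
    · left
      refine ⟨?_, ?_⟩
      · rw [← subtype_inter']; exact subtype_mem_toSub h1
      · rw [← subtype_sdiff_self, ← subtype_sdiff_self, ← subtype_inter']
        exact subtype_mem_toSub h2
    · right
      refine ⟨?_, ?_⟩
      · rw [← subtype_sdiff_self, ← subtype_inter']; exact subtype_mem_toSub h1
      · rw [← subtype_sdiff_self, ← subtype_inter']; exact subtype_mem_toSub h2

end PercRepro.MSTight
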